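import Literature.Topology.FourManifolds.SimplifiedBrokenLefschetzRoundCritical
import Literature.Topology.FourManifolds.RegularLevelMorseData
import HarnessLib

/-!
# Round slices of a simplified broken Lefschetz fibration: the transverse 3-dimensional slice
# through a round point is Morse with one critical point of index `1` or `2`

Topic `Literature/Topology/FourManifolds`; a brick for the named fact
`Literature.Topology.FourManifolds.nonempty_diffeomorph_sphere_four_of_sblf_genus_one_noLefschetz`
(Baykur–Kamada 2015, Lemma 11) of `SimplifiedBrokenLefschetzFibration.lean`.  Everything here is
**proved**; there are no definitions and no named facts.

Baykur–Kamada 2015, §2 (arXiv p. 7) decompose the total space of an SBLF into the lower side,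
the higher side *"and a round cobordism between them containing the round singular set in the
interior"*; Baykur 2012, proof of Lemma 7: *"a round cobordism … is composed of `S¹` times a
`3`-dimensional `1`-handle cobordism"*; Hayano 2011, §2.3 and Auroux–Donaldson–Katzarkov 2005,
§8.1: the indefinite fold `(t, x₁, x₂, x₃) ↦ (t, x₁² + x₂² - x₃²)` (Hayano 2011, Def. 2.1 (4))
is, in the slice `t = const` transverse to the fold arc, the `3`-dimensional Morse function
`x₁² + x₂² - x₃²` with one critical point of index `1` (read from the side `x₁² + x₂² - x₃² < 0`).
This file proves the GLOBAL form of that slice statement for an SBLF `f : X⁴ → S²` without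
Lefschetz points whose round image is the equator `E = {y | y₂ = 0}` (normalisation
`IsSimplifiedBrokenLefschetzFibration.exists_image_round_eq_sphereEquator`,
`SimplifiedBrokenLefschetzRoundImage.lean`):

* `IsSimplifiedBrokenLefschetzFibration.isRegularLevel_height_single_one_comp` — **the
  meridian slice is a closed `3`-manifold**: `0` is a regular level of `y₁ ∘ f = ⟪e₁, f⟫`, so
  `P = f⁻¹{y | y 1 = 0}` (the preimage of the great circle through `(±1, 0, 0)` and the poles
  `(0, 0, ±1)`) is a regular level in the sense of `RegularLevelSet.lean`
  (`RegularLevel`, with its `C^∞` structure from slice charts; compact when `X` is).  At regular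
  points of `f` this is the chain rule (the height `y₁` is critical on `S²` only at `±e₁ ∉ P`);
  at the round points of `P` (those over `(±1, 0, 0)`) it is the transversality of the great
  circle to the round image read in a fold chart (`SphereGerm.morseData…`: `∂ₜΓ₁ ≠ 0`).
* `IsSimplifiedBrokenLefschetzFibration.isMCriticalPt_height_comp_incl_of_round` — for a height
  `⟪a, ·⟫` with `a = (a₀, 0, a₂)`, `a₀ ≠ 0`, the round points of `P` are critical points of
  `⟪a, f⟫` restricted to `P` (they are even critical on `X`,
  `isMCriticalPt_height_comp_iff_of_round`).
* `IsSimplifiedBrokenLefschetzFibration.nondegenerate_and_morseIndex_height_comp_incl_of_fold_chart`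
  — **the Morse data of the slice function at a round point**: for `a₀ ≠ 0`, `a₂ ≠ 0` the
  restriction of `⟪a, f⟫` to `P` has at a round point `q` of `P` a nondegenerate critical
  point whose index is `1` if `a₂ ∂ₛΓ₂ > 0` and `2` otherwise, where `Γ = ψ⁻¹` is the base
  chart of a fold chart centred at `q` and `∂ₛ` the derivative across the fold image: in the
  fold chart the Hessian of `⟪a, f⟫` on `X` is `diag(α, 2β, 2β, -2β)`, `β = a₂ ∂ₛΓ₂`
  (`SimplifiedBrokenLefschetzMorseCharts.lean`), the tangent space of `P` is the hyperplane
  `{dt = 0}` (`RegularLevelMorseData.lean`: `morseIndex_comp_incl_eq`), and the restricted form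
  is `2β (x₁² + x₂² - x₃²)`.  Chart-free: the critical point is nondegenerate of index `1` or
  `2` (`nondegenerate_and_morseIndex_height_comp_incl_of_round`).
* `IsSimplifiedBrokenLefschetzFibration.apply_two_mul_eq_of_isMCriticalPt_height_comp_incl`,
  `IsSimplifiedBrokenLefschetzFibration.sq_height_eq_of_isMCriticalPt_comp_incl` — **no other
  critical points near the equator**: at a regular point `x ∈ P` of `f`, if `⟪a, f⟫|_P` is
  critical then `a₂ (f x)₀ = a₀ (f x)₂` and hence `⟪a, f x⟫² = a₀² + a₂²` (Lagrange: `⟪a, ·⟫`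
  must be critical along the great circle `{y₁ = 0}`, i.e. `f x = ± a/‖a‖`); so every critical
  point of the slice function with `⟪a, f⟫² < a₀² + a₂²` is a round point.

The sign `a₂ ∂ₛΓ₂ > 0` — i.e. that the `s > 0` side of every fold chart is the higher-genus
hemisphere — and hence the index `1` from the lower side, is global information supplied by the
Euler-characteristic count of the companion file `SimplifiedBrokenLefschetzRoundSlicesIndex.lean`.

## References

* R. İ. Baykur, S. Kamada, *Classification of broken Lefschetz fibrations with small fiber
  genera*, J. Math. Soc. Japan 67 (2015), §2 (arXiv:1010.5814, p. 7), Lemma 11. [BaykurKamada2015]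
* R. İ. Baykur, *Broken Lefschetz fibrations and smooth structures on 4-manifolds*, Geom. Topol.
  Monogr. 18 (2012), proof of Lemma 7. [Baykur2012]
* K. Hayano, *On genus-1 simplified broken Lefschetz fibrations*, Algebr. Geom. Topol. 11 (2011),
  Def. 2.1 (4), §2.3. [Hayano2011]
* J. Milnor, *Morse theory* (1963), §2. [Milnor1963]
-/

noncomputable section

open scoped Manifold ContDiff Topology RealInnerProductSpace
open Set Function Filter Metric

namespace Literature.Topology.FourManifolds

universe u

/-! ### The slice form `2β (v₀ w₀ + v₁ w₁ - v₂ w₂)` on `ℝ³`: index and nondegeneracy -/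

section SliceForm

/-- **Negative index of inertia of the slice Hessian form.**  For `β ≠ 0` the symmetric
bilinear form `B (v, w) = 2β (v₀ w₀ + v₁ w₁ - v₂ w₂)` on `ℝ³` — the Hessian of the transverse
slice `x₁² + x₂² - x₃²` of the indefinite fold scaled by `β` — has `sigNeg B = 1` if `β > 0` and
`2` if `β < 0` (Sylvester; Milnor 1963, §2). [cite: Milnor1963, §2] -/
theorem sigNeg_of_forall_apply_eq_sliceForm (B : LinearMap.BilinForm ℝ (EuclideanSpace ℝ (Fin 3)))
    {β : ℝ} (hβ : β ≠ 0)
    (hB : ∀ v w, B v w = β * (2 * (v 0 * w 0 + v 1 * w 1 - v 2 * w 2))) :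
    sigNeg B.toQuadraticMap = if 0 < β then 1 else 2 := by
  classical
  set d : Fin 3 → ℝ := ![2 * β, 2 * β, -(2 * β)] with hd
  have hdiag : ∀ i : Fin 3, B (EuclideanSpace.single i (1 : ℝ)) (EuclideanSpace.single i (1 : ℝ)) = d i := by
    intro i
    rw [hB]
    fin_cases i <;> simp [hd] <;> ring
  have horth : Pairwise fun i j : Fin 3 =>
      B (EuclideanSpace.single i (1 : ℝ)) (EuclideanSpace.single j (1 : ℝ)) = 0 := by
    intro i j hij
    rw [hB]
    fin_cases i <;> fin_cases j <;> simp_all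
  have h0 : ∀ i : Fin 3, B (EuclideanSpace.single i (1 : ℝ)) (EuclideanSpace.single i (1 : ℝ)) ≠ 0 := by
    intro i
    rw [hdiag]
    fin_cases i <;> simp [hd, hβ]
  have hcard : Fintype.card (Fin 3) = Module.finrank ℝ (EuclideanSpace ℝ (Fin 3)) := by simp
  obtain ⟨-, hneg⟩ := LinearMap.BilinForm.sigPos_eq_card_of_orthogonal B
    (fun i : Fin 3 => EuclideanSpace.single i (1 : ℝ)) horth h0 hcard
  rw [hneg]
  simp_rw [hdiag]
  rw [Fintype.card_subtype]
  have huniv : (Finset.univ : Finset (Fin 3)) = {0, 1, 2} := by decide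
  rw [huniv]
  rcases lt_or_gt_of_ne hβ with hβ' | hβ'
  · have hb1 : 2 * β < 0 := by linarith
    have hb2 : ¬ (-(2 * β) < 0) := by linarith
    have hb3 : ¬ (0 : ℝ) < β := not_lt.2 hβ'.le
    simp [Finset.filter_insert, Finset.filter_singleton, hd, hb1, hb2, hb3]
  · have hb1 : ¬ 2 * β < 0 := by linarith
    have hb2 : -(2 * β) < 0 := by linarith
    simp [Finset.filter_insert, Finset.filter_singleton, hd, hb1, hb2, hβ']

/-- **Nondegeneracy of the slice Hessian form**: `B (v, w) = 2β (v₀ w₀ + v₁ w₁ - v₂ w₂)` is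
nondegenerate iff `β ≠ 0`. [folklore] -/
theorem nondegenerate_iff_of_forall_apply_eq_sliceForm
    (B : LinearMap.BilinForm ℝ (EuclideanSpace ℝ (Fin 3))) {β : ℝ}
    (hB : ∀ v w, B v w = β * (2 * (v 0 * w 0 + v 1 * w 1 - v 2 * w 2))) :
    B.Nondegenerate ↔ β ≠ 0 := by
  constructor
  · rintro ⟨hl, -⟩ hβ
    have := hl (EuclideanSpace.single (0 : Fin 3) (1 : ℝ)) (fun w => by rw [hB]; simp [hβ])
    have h := congrArg (fun v : EuclideanSpace ℝ (Fin 3) => v 0) this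
    simp at h
  · intro hβ
    have key : ∀ v : EuclideanSpace ℝ (Fin 3), (∀ w, B v w = 0) → v = 0 := by
      intro v hv
      have e0 := hv (EuclideanSpace.single (0 : Fin 3) (1 : ℝ))
      have e1 := hv (EuclideanSpace.single (1 : Fin 3) (1 : ℝ))
      have e2 := hv (EuclideanSpace.single (2 : Fin 3) (1 : ℝ))
      rw [hB] at e0 e1 e2
      simp at e0 e1 e2
      ext i
      fin_cases i
      · rcases e0 with h | h
        · exact absurd h hβ
        · simpa using h
      · rcases e1 with h | h
        · exact absurd h hβ
        · simpa using h
      · rcases e2 with h | h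
        · exact absurd h hβ
        · simpa using h
    have hsymm : ∀ v w, B v w = B w v := fun v w => by rw [hB, hB]; ring
    exact ⟨fun v hv => key v hv, fun v hv => key v fun w => by rw [hsymm]; exact hv w⟩

end SliceForm

/-! ### Two facts about heights on the round `2`-sphere -/

section Sphere

open SphereHeight

/-- The height `⟪e₁, ·⟫` is the coordinate `y₁`. [folklore] -/
theorem height_single_apply (i : Fin 3) (y : (Metric.sphere (0 : EuclideanSpace ℝ (Fin 3)) 1)) :
    height (EuclideanSpace.single i (1 : ℝ)) y = (y : EuclideanSpace ℝ (Fin 3)) i := by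
  rw [height_apply, EuclideanSpace.inner_single_left]
  simp

/-- **Tangent vectors of the sphere**: a vector `u` orthogonal to `y ∈ S²` is the image of a
tangent vector under the differential of the inclusion (Mathlib's `range_mfderiv_coe_sphere`).
[folklore] -/
theorem exists_mfderiv_coe_sphere_eq {y : (Metric.sphere (0 : EuclideanSpace ℝ (Fin 3)) 1)}
    {u : EuclideanSpace ℝ (Fin 3)} (hu : ⟪(y : EuclideanSpace ℝ (Fin 3)), u⟫ = 0) :
    ∃ ξ : EuclideanSpace ℝ (Fin 2),
      mfderiv (𝓡 2) 𝓘(ℝ, EuclideanSpace ℝ (Fin 3))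
        ((↑) : (Metric.sphere (0 : EuclideanSpace ℝ (Fin 3)) 1) → EuclideanSpace ℝ (Fin 3)) y ξ = u := by
  haveI : Fact (Module.finrank ℝ (EuclideanSpace ℝ (Fin 3)) = 2 + 1) := ⟨finrank_euclideanSpace_fin⟩
  have hmem : u ∈ (ℝ ∙ (y : EuclideanSpace ℝ (Fin 3)))ᗮ :=
    Submodule.mem_orthogonal_singleton_iff_inner_right.2 hu
  rw [← range_mfderiv_coe_sphere (n := 2) y] at hmem
  obtain ⟨ξ, hξ⟩ := hmem
  exact ⟨ξ, hξ⟩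

/-- **The differential of a height along a tangent vector**: `d⟪b, ·⟫_y ξ = ⟪b, dι_y ξ⟫`, `ι` the
inclusion of the sphere (chain rule, `SphereHeight.hasMFDerivAt_height`). [folklore] -/
theorem mfderiv_height_apply (b : EuclideanSpace ℝ (Fin 3))
    (y : (Metric.sphere (0 : EuclideanSpace ℝ (Fin 3)) 1)) (ξ : EuclideanSpace ℝ (Fin 2)) :
    mfderiv (𝓡 2) 𝓘(ℝ, ℝ) (height b) y ξ =
      ⟪b, mfderiv (𝓡 2) 𝓘(ℝ, EuclideanSpace ℝ (Fin 3))
        ((↑) : (Metric.sphere (0 : EuclideanSpace ℝ (Fin 3)) 1) → EuclideanSpace ℝ (Fin 3)) y ξ⟫ := by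
  haveI : Fact (Module.finrank ℝ (EuclideanSpace ℝ (Fin 3)) = 2 + 1) := ⟨finrank_euclideanSpace_fin⟩
  rw [(hasMFDerivAt_height b y).mfderiv]
  rfl

end Sphere

/-! ### The meridian slice `P = f⁻¹{y | y₁ = 0}` is a regular level -/

namespace IsSimplifiedBrokenLefschetzFibration

open SphereHeight

variable {X : Type u} [TopologicalSpace X] [ChartedSpace (EuclideanSpace ℝ (Fin 4)) X]
  [IsManifold (𝓡 4) ∞ X] {o : SmoothOrientation (𝓡 4) X}
  {f : X → (Metric.sphere (0 : EuclideanSpace ℝ (Fin 3)) 1)} {h : ℕ}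

/-- **The meridian slice of a Lefschetz-free SBLF with equatorial round image is a closed
`3`-manifold**: `0` is a regular level (in the interior, `RegularLevelSet.lean`) of the height
`⟪e₁, ·⟫ ∘ f = (f ·)₁`, whose zero set is the preimage `P` of the great circle `{y | y₁ = 0}`
through the round values `(±1, 0, 0)` and the poles `(0, 0, ±1)`.  At a regular point `x` of
`f` the chain rule applies (`⟪e₁, ·⟫` is critical on `S²` only at `±e₁`, where `y₁ = ±1`); at a
round point of `P` — a point over `(±1, 0, 0)` — the germ `Γ = ψ⁻¹` of a fold chart satisfies
`∂ₜΓ₁(0) ≠ 0` (`SphereGerm.morseData_of_fderiv_single_zero_zero_eq_zero`: the round image, the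
equator, crosses the great circle transversally), so `∂ₜ(⟪e₁, ·⟫ ∘ Γ) ≠ 0` and `x` is not
critical for `(f ·)₁` (`isMCriticalPt_comp_iff_of_fold_chart`).
[cite: Hayano2011, Def. 2.1 (4)] [cite: HirschDT1976, Ch. 1 §3, Thm. 3.2] -/
theorem isRegularLevel_height_single_one_comp (hf : IsSimplifiedBrokenLefschetzFibration o f ∅ h)
    (hround : f '' ({p : X | ¬ Surjective (mfderiv (𝓡 4) (𝓡 2) f p)} \
      (↑(∅ : Finset X) : Set X)) = sphereEquator 1) :
    IsRegularLevel (𝓡 4) (height (EuclideanSpace.single (1 : Fin 3) (1 : ℝ)) ∘ f) 0 := by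
  set e₁ : EuclideanSpace ℝ (Fin 3) := EuclideanSpace.single (1 : Fin 3) (1 : ℝ) with he₁
  have he₁0 : e₁ ≠ 0 := by
    intro h0
    have := congrArg (fun v : EuclideanSpace ℝ (Fin 3) => v 1) h0
    simp [he₁] at this
  refine ⟨(contMDiff_height e₁).comp hf.contMDiff, fun x _ => BoundarylessManifold.isInteriorPoint,
    fun x hx hcrit => ?_⟩
  have hx1 : ((f x : (Metric.sphere (0 : EuclideanSpace ℝ (Fin 3)) 1)) : EuclideanSpace ℝ (Fin 3)) 1 = 0 := by
    have : height e₁ (f x) = 0 := hx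
    rwa [he₁, height_single_apply] at this
  by_cases hs : Surjective (mfderiv (𝓡 4) (𝓡 2) f x)
  · -- regular point of `f`: `⟪e₁, ·⟫` would be critical at `f x`, forcing `(f x)₁ = ±1`
    have hfd : MDifferentiableAt (𝓡 4) (𝓡 2) f x := hf.contMDiff.mdifferentiableAt (by simp)
    have hℓd : MDifferentiableAt (𝓡 2) 𝓘(ℝ, ℝ) (height e₁) (f x) :=
      (contMDiff_height e₁).mdifferentiableAt (by simp)
    have hcritS : IsMCriticalPt (𝓡 2) (height e₁) (f x) :=
      (isMCriticalPt_comp_iff_of_surjective_mfderiv hfd hℓd hs).1 hcrit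
    rcases coe_eq_or_eq_neg_of_isMCriticalPt he₁0 hcritS with h1 | h1
    · have := congrArg (fun v : EuclideanSpace ℝ (Fin 3) => v 1) h1
      simp [he₁, hx1] at this
    · have := congrArg (fun v : EuclideanSpace ℝ (Fin 3) => v 1) h1
      simp [he₁, hx1] at this
  · -- round point: transversality of the great circle to the round image in a fold chart
    have hxL : x ∉ (∅ : Finset X) := Finset.notMem_empty x
    obtain ⟨φ, ψ, hq, hq0, hmaps, hφ, hφs, hψ, hψs, hmodel⟩ := hf.fold x hs hxL
    obtain ⟨hΓ, hS, hE, hinj, hΓ0⟩ :=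
      hf.sphereGerm_of_fold_chart hround hq hq0 hmaps hφ hφs hψ hψs hmodel
    set Γ : EuclideanSpace ℝ (Fin 2) → EuclideanSpace ℝ (Fin 3) :=
      fun w => ((ψ.symm w : Metric.sphere (0 : EuclideanSpace ℝ (Fin 3)) 1) :
        EuclideanSpace ℝ (Fin 3)) with hΓdef
    have haxis : (φ x) 1 = 0 ∧ (φ x) 2 = 0 ∧ (φ x) 3 = 0 := by rw [hq0]; simp
    have hψ0 : ψ (f x) = 0 := base_apply_eq_zero_of_fold_chart hmodel hq hq0
    have hΓ01 : Γ 0 1 = 0 := by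
      show ((ψ.symm 0 : Metric.sphere (0 : EuclideanSpace ℝ (Fin 3)) 1) : EuclideanSpace ℝ (Fin 3)) 1 = 0
      rw [hΓ0]; exact hx1
    have h0 : fderiv ℝ Γ 0 (EuclideanSpace.single (0 : Fin 2) (1 : ℝ)) 0 = 0 :=
      (SphereGerm.fderiv_single_zero_zero_eq_zero_iff hΓ hS hE hinj).2 hΓ01
    obtain ⟨-, hc, -, -, -⟩ :=
      SphereGerm.morseData_of_fderiv_single_zero_zero_eq_zero hΓ hS hE hinj h0
    have key := (isMCriticalPt_comp_iff_of_fold_chart hmaps hφ hφs hψs hmodel hf.contMDiff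
      (contMDiff_height e₁) hq haxis).1 hcrit
    rw [hψ0, height_comp_symm_eq, fderiv_inner_comp_apply e₁ (hΓ.differentiableAt (by simp)),
      he₁, EuclideanSpace.inner_single_left] at key
    simp only [map_one, one_mul] at key
    exact hc key

omit [IsManifold (𝓡 4) ∞ X] in
/-- Points of the meridian slice have `(f ·)₁ = 0`. [folklore] -/
theorem apply_one_eq_zero_of_regularLevel
    (hP : IsRegularLevel (𝓡 4) (height (EuclideanSpace.single (1 : Fin 3) (1 : ℝ)) ∘ f) 0)
    (p : RegularLevel hP) :
    ((f p.1 : (Metric.sphere (0 : EuclideanSpace ℝ (Fin 3)) 1)) : EuclideanSpace ℝ (Fin 3)) 1 = 0 := by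
  have : height (EuclideanSpace.single (1 : Fin 3) (1 : ℝ)) (f p.1) = 0 := p.2
  rwa [height_single_apply] at this

/-! ### Round points of the slice: critical, nondegenerate, of index `1` or `2` -/

/-- **The round points of the slice are critical for the slice function.**  For a height
`⟪a, ·⟫` with `a = (a₀, 0, a₂)`, `a₀ ≠ 0`, a round point `q` of `P = {(f ·)₁ = 0}` is a critical
point of `⟪a, f⟫` on `X` (`isMCriticalPt_height_comp_iff_of_round`: round points of `P` lie
over `(±1, 0, 0)`, where `⟪a, ·⟫` is critical along the equator), hence of its restriction to
`P` (`RegularLevel.isMCriticalPt_comp_incl_of_isMCriticalPt`). [cite: Milnor1963, §2] -/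
theorem isMCriticalPt_height_comp_incl_of_round (hf : IsSimplifiedBrokenLefschetzFibration o f ∅ h)
    (hround : f '' ({p : X | ¬ Surjective (mfderiv (𝓡 4) (𝓡 2) f p)} \
      (↑(∅ : Finset X) : Set X)) = sphereEquator 1)
    {a : EuclideanSpace ℝ (Fin 3)} (ha1 : a 1 = 0) (ha0 : a 0 ≠ 0)
    (hP : IsRegularLevel (𝓡 4) (height (EuclideanSpace.single (1 : Fin 3) (1 : ℝ)) ∘ f) 0)
    (p : RegularLevel hP)
    (hps : ¬ Surjective (mfderiv (𝓡 4) (𝓡 2) f p.1)) :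
    IsMCriticalPt (𝓡 3)
      ((height a ∘ f) ∘ RegularLevel.incl hP) p := by
  have hcrit : IsMCriticalPt (𝓡 4) (height a ∘ f) p.1 :=
    (hf.isMCriticalPt_height_comp_iff_of_round hround hps (Finset.notMem_empty _) ha1 ha0).2
      (apply_one_eq_zero_of_regularLevel hP p)
  have hF : ContMDiffAt (𝓡 4) 𝓘(ℝ, ℝ) 2 (height a ∘ f) p.1 :=
    (((contMDiff_height a).comp hf.contMDiff) p.1).of_le (by norm_cast)
  exact RegularLevel.isMCriticalPt_comp_incl_of_isMCriticalPt p hF hcrit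

/-- **Morse data of the slice function at a round point, read in a fold chart** (Milnor 1963,
§2; Hayano 2011, Def. 2.1 (4)).  Let `q` be a round point of the slice `P = {(f ·)₁ = 0}`,
`(φ, ψ)` a fold chart centred at `q`, `Γ = ψ⁻¹ : ℝ² → S² ⊆ ℝ³`, and `a = (a₀, 0, a₂)` with
`a₀ ≠ 0`, `a₂ ≠ 0`.  Then `q` is a nondegenerate critical point of `⟪a, f⟫|_P` of index `1`
if `a₂ ∂ₛΓ₂(0) > 0` and `2` otherwise: the Hessian of `⟪a, f⟫` on `X` in the fold chart is
`diag(α, 2β, 2β, -2β)` with `β = ∂ₛ(⟪a, ·⟫ ∘ Γ) = a₂ ∂ₛΓ₂` (`hessianInChart_of_fold_chart`,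
`SphereGerm.morseData…`: `∂ₛΓ₀ = 0`), the tangent hyperplane of `P` at `q` read in `φ` is
`{dt = 0}` (`(f ·)₁ ∘ φ⁻¹ = (⟪e₁, ·⟫ ∘ Γ) ∘ N` has differential `∂ₜΓ₁ dt`, `∂ₜΓ₁ ≠ 0`), and the
Hessian of the restriction is the restriction of the Hessian
(`RegularLevel.morseIndex_comp_incl_eq`, `RegularLevel.nondegenerate_mhessian_comp_incl_iff`),
i.e. the slice form `2β (x₁² + x₂² - x₃²)`. [cite: Milnor1963, §2] [cite: Hayano2011, Def. 2.1 (4)] -/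
theorem nondegenerate_and_morseIndex_height_comp_incl_of_fold_chart
    (hf : IsSimplifiedBrokenLefschetzFibration o f ∅ h)
    (hround : f '' ({p : X | ¬ Surjective (mfderiv (𝓡 4) (𝓡 2) f p)} \
      (↑(∅ : Finset X) : Set X)) = sphereEquator 1)
    {a : EuclideanSpace ℝ (Fin 3)} (ha1 : a 1 = 0) (ha0 : a 0 ≠ 0) (ha2 : a 2 ≠ 0)
    (hP : IsRegularLevel (𝓡 4) (height (EuclideanSpace.single (1 : Fin 3) (1 : ℝ)) ∘ f) 0)
    (p : RegularLevel hP)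
    {φ : OpenPartialHomeomorph X (EuclideanSpace ℝ (Fin 4))}
    {ψ : OpenPartialHomeomorph (Metric.sphere (0 : EuclideanSpace ℝ (Fin 3)) 1)
      (EuclideanSpace ℝ (Fin 2))}
    (hq : p.1 ∈ φ.source) (hq0 : φ p.1 = 0) (hmaps : Set.MapsTo f φ.source ψ.source)
    (hφ : ContMDiffOn (𝓡 4) (𝓡 4) ∞ φ φ.source) (hφs : ContMDiffOn (𝓡 4) (𝓡 4) ∞ φ.symm φ.target)
    (hψ : ContMDiffOn (𝓡 2) (𝓡 2) ∞ ψ ψ.source) (hψs : ContMDiffOn (𝓡 2) (𝓡 2) ∞ ψ.symm ψ.target)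
    (hmodel : ∀ q ∈ φ.source, (ψ (f q)) 0 = (φ q) 0 ∧
      (ψ (f q)) 1 = (φ q) 1 ^ 2 + (φ q) 2 ^ 2 - (φ q) 3 ^ 2) :
    (mhessian (𝓡 3) ((height a ∘ f) ∘
        RegularLevel.incl hP) p).Nondegenerate ∧
      morseIndex (𝓡 3) ((height a ∘ f) ∘
          RegularLevel.incl hP) p =
        if 0 < a 2 * fderiv ℝ (fun w => ((ψ.symm w : Metric.sphere (0 : EuclideanSpace ℝ (Fin 3)) 1) :
            EuclideanSpace ℝ (Fin 3))) 0 (EuclideanSpace.single (1 : Fin 2) (1 : ℝ)) 2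
        then 1 else 2 := by
  obtain ⟨q, hqP⟩ := p
  -- the round point: every point of a centred fold chart axis is critical for `f`
  have hps : ¬ Surjective (mfderiv (𝓡 4) (𝓡 2) f q) := by
    intro hs
    have h1' : (1 : ℕ∞ω) ≤ ∞ := by exact_mod_cast le_top
    have h1 := (surjective_mfderiv_iff_of_fold_chart hmaps (hφ.of_le h1') (hφs.of_le h1') (hψ.of_le h1')
      (hψs.of_le h1') hmodel hq (hf.contMDiff.mdifferentiableAt (by simp))).1 hs
    rw [hq0] at h1
    simp at h1
  obtain ⟨hΓ, hS, hE, hinj, hΓ0⟩ :=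
    hf.sphereGerm_of_fold_chart hround hq hq0 hmaps hφ hφs hψ hψs hmodel
  set Γ : EuclideanSpace ℝ (Fin 2) → EuclideanSpace ℝ (Fin 3) :=
    fun w => ((ψ.symm w : Metric.sphere (0 : EuclideanSpace ℝ (Fin 3)) 1) :
      EuclideanSpace ℝ (Fin 3)) with hΓdef
  have haxis : (φ q) 1 = 0 ∧ (φ q) 2 = 0 ∧ (φ q) 3 = 0 := by rw [hq0]; simp
  have hψ0 : ψ (f q) = 0 := base_apply_eq_zero_of_fold_chart hmodel hq hq0
  have hq1 : ((f q : (Metric.sphere (0 : EuclideanSpace ℝ (Fin 3)) 1)) : EuclideanSpace ℝ (Fin 3)) 1 = 0 :=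
    apply_one_eq_zero_of_regularLevel hP ⟨q, hqP⟩
  have hΓ01 : Γ 0 1 = 0 := by
    show ((ψ.symm 0 : Metric.sphere (0 : EuclideanSpace ℝ (Fin 3)) 1) : EuclideanSpace ℝ (Fin 3)) 1 = 0
    rw [hΓ0]; exact hq1
  have h0 : fderiv ℝ Γ 0 (EuclideanSpace.single (0 : Fin 2) (1 : ℝ)) 0 = 0 :=
    (SphereGerm.fderiv_single_zero_zero_eq_zero_iff hΓ hS hE hinj).2 hΓ01
  obtain ⟨-, hc, -, htan0, htan2⟩ :=
    SphereGerm.morseData_of_fderiv_single_zero_zero_eq_zero hΓ hS hE hinj h0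
  -- the transverse derivative `β = a₂ ∂ₛΓ₂` of the height, and `∂ₜΓ₁` of the level function
  set B : ℝ := fderiv ℝ Γ 0 (EuclideanSpace.single (1 : Fin 2) (1 : ℝ)) 2 with hBdef
  set β : ℝ := a 2 * B with hβdef
  have hβ0 : β ≠ 0 := mul_ne_zero ha2 htan2
  have hβ : fderiv ℝ (height a ∘ ψ.symm) (ψ (f q)) (EuclideanSpace.single (1 : Fin 2) (1 : ℝ)) = β := by
    rw [hψ0, height_comp_symm_eq, fderiv_inner_comp_apply a (hΓ.differentiableAt (by simp)),
      inner_eq_of_apply_one_eq_zero ha1, htan0, mul_zero, zero_add]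
  have hlev : fderiv ℝ (height (EuclideanSpace.single (1 : Fin 3) (1 : ℝ)) ∘ ψ.symm) (ψ (f q)) (EuclideanSpace.single (0 : Fin 2) (1 : ℝ)) =
      fderiv ℝ Γ 0 (EuclideanSpace.single (0 : Fin 2) (1 : ℝ)) 1 := by
    rw [hψ0, height_comp_symm_eq, fderiv_inner_comp_apply _ (hΓ.differentiableAt (by simp)),
      EuclideanSpace.inner_single_left]
    simp
  -- ambient criticality, the fold chart in the maximal atlas
  have hcrit : IsMCriticalPt (𝓡 4) (height a ∘ f) q :=
    (hf.isMCriticalPt_height_comp_iff_of_round hround hps (Finset.notMem_empty _) ha1 ha0).2 hq1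
  have hF : ContMDiffAt (𝓡 4) 𝓘(ℝ, ℝ) 2 (height a ∘ f) q :=
    (((contMDiff_height a).comp hf.contMDiff) q).of_le (by norm_cast)
  have he : φ ∈ IsManifold.maximalAtlas (𝓡 4) ∞ X :=
    OpenPartialHomeomorph.mem_maximalAtlas_of_contMDiffOn φ hφ hφs
  -- the Hessian of `⟪a, f⟫` on `X` in the fold chart
  have hN : ψ (f q) = (fun v : EuclideanSpace ℝ (Fin 4) =>
        (WithLp.toLp 2 ![v 0, v 1 ^ 2 + v 2 ^ 2 - v 3 ^ 2] : EuclideanSpace ℝ (Fin 2))) (φ q) := apply_eq_foldNormalForm_of_fold_chart hmodel hq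
  have hΛ : ContDiffAt ℝ 2 (height a ∘ ψ.symm) ((fun v : EuclideanSpace ℝ (Fin 4) =>
        (WithLp.toLp 2 ![v 0, v 1 ^ 2 + v 2 ^ 2 - v 3 ^ 2] : EuclideanSpace ℝ (Fin 2))) (φ q)) := by
    rw [← hN]
    exact (contDiffAt_comp_symm_of_chart hψs (contMDiff_height a) (ψ.map_source (hmaps hq))).of_le
      (by norm_cast)
  have hform : ∀ v w, hessianInChart (𝓡 4) φ (height a ∘ f) q v w =
      fderiv ℝ (fderiv ℝ (height a ∘ ψ.symm)) (ψ (f q)) (EuclideanSpace.single (0 : Fin 2) (1 : ℝ))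
          (EuclideanSpace.single (0 : Fin 2) (1 : ℝ)) * (v 0 * w 0) +
        β * (2 * (v 1 * w 1 + v 2 * w 2 - v 3 * w 3)) := fun v w => by
    rw [hessianInChart_of_fold_chart hmaps hmodel hq, fderiv_fderiv_comp_foldNormalForm_apply hΛ haxis,
      ← hN, hβ]
  -- the tangent hyperplane of `P` read in the fold chart is `{v | v 0 = 0}`
  have hΛ₁ : DifferentiableAt ℝ (height (EuclideanSpace.single (1 : Fin 3) (1 : ℝ)) ∘ ψ.symm) ((fun v : EuclideanSpace ℝ (Fin 4) =>
        (WithLp.toLp 2 ![v 0, v 1 ^ 2 + v 2 ^ 2 - v 3 ^ 2] : EuclideanSpace ℝ (Fin 2))) (φ q)) := by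
    rw [← hN]
    exact (contDiffAt_comp_symm_of_chart hψs (contMDiff_height _) (ψ.map_source (hmaps hq))).differentiableAt
      (by simp)
  have hker : ∀ v : EuclideanSpace ℝ (Fin 4),
      fderiv ℝ ((height (EuclideanSpace.single (1 : Fin 3) (1 : ℝ)) ∘ f) ∘ φ.symm) (φ q) v = 0 ↔ v 0 = 0 := by
    intro v
    rw [(comp_symm_eventuallyEq_of_fold_chart (ℓ := height (EuclideanSpace.single (1 : Fin 3) (1 : ℝ))) hmaps hmodel (φ.map_source hq)).fderiv_eq,
      fderiv_comp_foldNormalForm_apply hΛ₁ haxis, ← hN, hlev]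
    constructor
    · intro hv
      exact (mul_eq_zero.1 hv).resolve_right hc
    · intro hv; rw [hv, zero_mul]
  -- Morse data of the restriction through the restricted form
  have hind := RegularLevel.morseIndex_comp_incl_eq (h := hP) ⟨q, hqP⟩ hF hcrit he hq
  have hndiff := RegularLevel.nondegenerate_mhessian_comp_incl_iff (h := hP) ⟨q, hqP⟩ hF hcrit he hq
  set V := LinearMap.ker (fderiv ℝ ((height (EuclideanSpace.single (1 : Fin 3) (1 : ℝ)) ∘ f) ∘ φ.symm) (φ q) :
      EuclideanSpace ℝ (Fin 4) →ₗ[ℝ] ℝ) with hVdef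
  have hmemV : ∀ v : EuclideanSpace ℝ (Fin 4), v ∈ V ↔ v 0 = 0 := fun v => by
    rw [hVdef, LinearMap.mem_ker]; exact hker v
  -- the slice embedding `u ↦ (0, u₀, u₁, u₂)` onto `V`
  set J : EuclideanSpace ℝ (Fin 3) → EuclideanSpace ℝ (Fin 4) :=
    fun u => WithLp.toLp 2 ![0, u 0, u 1, u 2] with hJ
  have hJ0 : ∀ u, J u 0 = 0 := fun u => by simp [hJ]
  have hJ1 : ∀ u, J u 1 = u 0 := fun u => by simp [hJ]
  have hJ2 : ∀ u, J u 2 = u 1 := fun u => by simp [hJ]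
  have hJ3 : ∀ u, J u 3 = u 2 := fun u => by simp [hJ]
  have hJadd : ∀ u u', J (u + u') = J u + J u' := fun u u' => by
    ext i; fin_cases i <;> simp [hJ]
  have hJsmul : ∀ (c : ℝ) u, J (c • u) = c • J u := fun c u => by
    ext i; fin_cases i <;> simp [hJ]
  let L : EuclideanSpace ℝ (Fin 3) ≃ₗ[ℝ] V :=
    { toFun := fun u => ⟨J u, (hmemV _).2 (hJ0 u)⟩
      map_add' := fun u u' => by ext1; exact hJadd u u'
      map_smul' := fun c u => by ext1; exact hJsmul c u
      invFun := fun v => WithLp.toLp 2 ![(v : EuclideanSpace ℝ (Fin 4)) 1,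
        (v : EuclideanSpace ℝ (Fin 4)) 2, (v : EuclideanSpace ℝ (Fin 4)) 3]
      left_inv := fun u => by ext i; fin_cases i <;> simp [hJ]
      right_inv := fun v => by
        have hv0 : (v : EuclideanSpace ℝ (Fin 4)) 0 = 0 := (hmemV _).1 v.2
        ext i
        fin_cases i <;> simp [hJ, hv0] }
  have hLapply : ∀ u, ((L u : V) : EuclideanSpace ℝ (Fin 4)) = J u := fun u => rfl
  set H := (hessianInChart (𝓡 4) φ (height a ∘ f) q).restrict V with hHdef
  set B' : LinearMap.BilinForm ℝ (EuclideanSpace ℝ (Fin 3)) := H.congr L.symm with hB'def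
  have hB'H : ∀ v w, B' v w = H (L v) (L w) := fun v w => by
    rw [hB'def, LinearMap.BilinForm.congr_apply, LinearEquiv.symm_symm]
  have hB' : ∀ v w, B' v w = β * (2 * (v 0 * w 0 + v 1 * w 1 - v 2 * w 2)) := fun v w => by
    rw [hB'H]
    change hessianInChart (𝓡 4) φ (height a ∘ f) q (J v) (J w) = _
    rw [hform]
    simp only [hJ0, hJ1, hJ2, hJ3]
    ring
  constructor
  · rw [hndiff, ← nondegenerate_iff_of_forall_apply_eq L hB'H,
      nondegenerate_iff_of_forall_apply_eq_sliceForm B' hB']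
    exact hβ0
  · rw [hind, ← sigNeg_eq_of_forall_apply_eq L hB'H, sigNeg_of_forall_apply_eq_sliceForm B' hβ0 hB']

/-- **Morse data of the slice function at a round point, chart-free**: for `a = (a₀, 0, a₂)`
with `a₀ ≠ 0`, `a₂ ≠ 0`, a round point of the slice `P = {(f ·)₁ = 0}` is a nondegenerate
critical point of `⟪a, f⟫|_P` of index `1` or `2` (the two signs of `a₂ ∂ₛΓ₂` in
`nondegenerate_and_morseIndex_height_comp_incl_of_fold_chart`). [cite: Milnor1963, §2]
[cite: Hayano2011, Def. 2.1 (4)] -/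
theorem nondegenerate_and_morseIndex_height_comp_incl_of_round
    (hf : IsSimplifiedBrokenLefschetzFibration o f ∅ h)
    (hround : f '' ({p : X | ¬ Surjective (mfderiv (𝓡 4) (𝓡 2) f p)} \
      (↑(∅ : Finset X) : Set X)) = sphereEquator 1)
    {a : EuclideanSpace ℝ (Fin 3)} (ha1 : a 1 = 0) (ha0 : a 0 ≠ 0) (ha2 : a 2 ≠ 0)
    (hP : IsRegularLevel (𝓡 4) (height (EuclideanSpace.single (1 : Fin 3) (1 : ℝ)) ∘ f) 0)
    (p : RegularLevel hP)
    (hps : ¬ Surjective (mfderiv (𝓡 4) (𝓡 2) f p.1)) :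
    (mhessian (𝓡 3) ((height a ∘ f) ∘
        RegularLevel.incl hP) p).Nondegenerate ∧
      (morseIndex (𝓡 3) ((height a ∘ f) ∘
          RegularLevel.incl hP) p = 1 ∨
        morseIndex (𝓡 3) ((height a ∘ f) ∘
          RegularLevel.incl hP) p = 2) := by
  obtain ⟨φ, ψ, hq, hq0, hmaps, hφ, hφs, hψ, hψs, hmodel⟩ := hf.fold p.1 hps (Finset.notMem_empty _)
  obtain ⟨hnd, hind⟩ := hf.nondegenerate_and_morseIndex_height_comp_incl_of_fold_chart hround ha1 ha0
    ha2 hP p hq hq0 hmaps hφ hφs hψ hψs hmodel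
  refine ⟨hnd, ?_⟩
  rw [hind]
  split_ifs
  · exact Or.inl rfl
  · exact Or.inr rfl

/-! ### No other critical points: the slice function at regular points of `f` -/

/-- **Lagrange's condition at a regular point of `f` on the slice.**  Let `x ∈ P = {(f ·)₁ = 0}`
be a regular point of `f` at which `⟪a, f⟫|_P` is critical.  Then
`a₂ (f x)₀ = a₀ (f x)₂`, i.e. `⟪a, u⟫ = 0` for the vector `u = (-(f x)₂, 0, (f x)₀)` spanning the
tangent line of the great circle `{y₁ = 0}` at `f x`: by `RegularLevel.isMCriticalPt_comp_incl_iff_of_chart`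
the differential of `⟪a, f⟫` kills the kernel of the differential of `(f ·)₁`, which (as `df_x`
is onto) contains a vector mapped by `df_x` to the tangent vector `u` (`u ⊥ f x`, `u ⊥ e₁`).
[cite: LeeSmoothManifolds2013, Prop. 5.38] [cite: Milnor1963, §2] -/
theorem apply_two_mul_eq_of_isMCriticalPt_height_comp_incl
    (hf : IsSimplifiedBrokenLefschetzFibration o f ∅ h) (a : EuclideanSpace ℝ (Fin 3))
    (hP : IsRegularLevel (𝓡 4) (height (EuclideanSpace.single (1 : Fin 3) (1 : ℝ)) ∘ f) 0)
    (p : RegularLevel hP)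
    (hps : Surjective (mfderiv (𝓡 4) (𝓡 2) f p.1))
    (hcrit : IsMCriticalPt (𝓡 3) ((height a ∘ f) ∘
      RegularLevel.incl hP) p) :
    a 2 * ((f p.1 : (Metric.sphere (0 : EuclideanSpace ℝ (Fin 3)) 1)) : EuclideanSpace ℝ (Fin 3)) 0 =
      a 0 * ((f p.1 : (Metric.sphere (0 : EuclideanSpace ℝ (Fin 3)) 1)) : EuclideanSpace ℝ (Fin 3)) 2 := by
  obtain ⟨q, hqP⟩ := p
  set y : EuclideanSpace ℝ (Fin 3) :=
    ((f q : (Metric.sphere (0 : EuclideanSpace ℝ (Fin 3)) 1)) : EuclideanSpace ℝ (Fin 3)) with hydef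
  -- the chart at `q` and the chain rule for `⟪b, f⟫ ∘ e⁻¹`
  set e := chartAt (EuclideanSpace ℝ (Fin 4)) q with hedef
  have heatlas : e ∈ IsManifold.maximalAtlas (𝓡 4) ∞ X := IsManifold.chart_mem_maximalAtlas q
  have hqe : q ∈ e.source := mem_chart_source _ q
  have hsymmq : e.symm (e q) = q := e.left_inv hqe
  have hesd : MDifferentiableAt (𝓡 4) (𝓡 4) e.symm (e q) :=
    (mdifferentiable_chart q).mdifferentiableAt_symm (e.map_source hqe)
  have hfd : MDifferentiableAt (𝓡 4) (𝓡 2) f (e.symm (e q)) := by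
    rw [hsymmq]; exact hf.contMDiff.mdifferentiableAt (by simp)
  have hTd : MDifferentiableAt (𝓡 4) (𝓡 2) (f ∘ e.symm) (e q) := hfd.comp (e q) hesd
  have hT : mfderiv (𝓡 4) (𝓡 2) (f ∘ e.symm) (e q) =
      (mfderiv (𝓡 4) (𝓡 2) f q).comp (mfderiv (𝓡 4) (𝓡 4) e.symm (e q)) := by
    rw [mfderiv_comp (e q) hfd hesd, hsymmq]
  have hpt : (f ∘ e.symm) (e q) = f q := by
    show f (e.symm (e q)) = f q
    rw [hsymmq]
  have hchain : ∀ (b : EuclideanSpace ℝ (Fin 3)) (w : EuclideanSpace ℝ (Fin 4)),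
      fderiv ℝ ((height b ∘ f) ∘ e.symm) (e q) w =
        mfderiv (𝓡 2) 𝓘(ℝ, ℝ) (height b) ((f ∘ e.symm) (e q))
          (mfderiv (𝓡 4) (𝓡 2) (f ∘ e.symm) (e q) w) := by
    intro b w
    have hbd : MDifferentiableAt (𝓡 2) 𝓘(ℝ, ℝ) (height b) ((f ∘ e.symm) (e q)) :=
      (contMDiff_height b).mdifferentiableAt (by simp)
    have h1 : (height b ∘ f) ∘ e.symm = height b ∘ (f ∘ e.symm) := rfl
    rw [← mfderiv_eq_fderiv, h1, mfderiv_comp (e q) hbd hTd]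
    rfl
  -- Lagrange's condition in the chart `e`
  have hF : ContMDiffAt (𝓡 4) 𝓘(ℝ, ℝ) 2 (height a ∘ f) q :=
    (((contMDiff_height a).comp hf.contMDiff) q).of_le (by norm_cast)
  have key := (RegularLevel.isMCriticalPt_comp_incl_iff_of_chart (h := hP) ⟨q, hqP⟩ hF heatlas hqe).1 hcrit
  -- the tangent vector `u = (-(f q)₂, 0, (f q)₀)` of the great circle and a lift `w`
  set u : EuclideanSpace ℝ (Fin 3) := WithLp.toLp 2 ![-(y 2), 0, y 0] with hudef
  have hu0 : u 0 = -(y 2) := by simp [hudef]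
  have hu1 : u 1 = 0 := by simp [hudef]
  have hu2 : u 2 = y 0 := by simp [hudef]
  have hyu : ⟪(((f ∘ e.symm) (e q) : (Metric.sphere (0 : EuclideanSpace ℝ (Fin 3)) 1)) :
      EuclideanSpace ℝ (Fin 3)), u⟫ = 0 := by
    rw [hpt, ← hydef, BandFoliation.inner_eq_three, hu0, hu1, hu2]; ring
  obtain ⟨ξ, hξ⟩ := exists_mfderiv_coe_sphere_eq hyu
  have hTsurj : Surjective (mfderiv (𝓡 4) (𝓡 2) (f ∘ e.symm) (e q)) := by
    rw [hT]
    exact hps.comp ((mdifferentiable_chart q).symm.mfderiv_surjective (e.map_source hqe))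
  obtain ⟨w, hw⟩ := hTsurj ξ
  have hlevel : fderiv ℝ ((height (EuclideanSpace.single (1 : Fin 3) (1 : ℝ)) ∘ f) ∘ e.symm) (e q) w = 0 := by
    rw [hchain _ w, hw, mfderiv_height_apply, hξ, EuclideanSpace.inner_single_left]
    simp [hu1]
  have hzero := key w hlevel
  rw [hchain a w, hw, mfderiv_height_apply, hξ, BandFoliation.inner_eq_three, hu0, hu1, hu2] at hzero
  linarith

/-- **Critical values of the slice function at regular points of `f`**: if `⟪a, f⟫|_P` is
critical at a regular point `x ∈ P` of `f` and `a₁ = 0`, then `⟪a, f x⟫² = a₀² + a₂²`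
(`a₂ (f x)₀ = a₀ (f x)₂` and `(f x)₀² + (f x)₂² = 1`: Lagrange's identity).  Hence a critical
point of `⟪a, f⟫|_P` with `⟪a, f⟫² < a₀² + a₂²` is a round point. [cite: Milnor1963, §2] -/
theorem sq_height_eq_of_isMCriticalPt_comp_incl (hf : IsSimplifiedBrokenLefschetzFibration o f ∅ h)
    {a : EuclideanSpace ℝ (Fin 3)} (ha1 : a 1 = 0)
    (hP : IsRegularLevel (𝓡 4) (height (EuclideanSpace.single (1 : Fin 3) (1 : ℝ)) ∘ f) 0)
    (p : RegularLevel hP)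
    (hps : Surjective (mfderiv (𝓡 4) (𝓡 2) f p.1))
    (hcrit : IsMCriticalPt (𝓡 3) ((height a ∘ f) ∘
      RegularLevel.incl hP) p) :
    (height a (f p.1)) ^ 2 = a 0 ^ 2 + a 2 ^ 2 := by
  have hlag := hf.apply_two_mul_eq_of_isMCriticalPt_height_comp_incl a hP p hps hcrit
  have hq1 := apply_one_eq_zero_of_regularLevel hP p
  set y : EuclideanSpace ℝ (Fin 3) :=
    ((f p.1 : (Metric.sphere (0 : EuclideanSpace ℝ (Fin 3)) 1)) : EuclideanSpace ℝ (Fin 3)) with hydef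
  have hnorm : ‖y‖ = 1 := norm_eq_of_mem_sphere (f p.1)
  have hsq : y 0 ^ 2 + y 2 ^ 2 = 1 := by
    have : ‖y‖ ^ 2 = 1 := by rw [hnorm, one_pow]
    rw [← real_inner_self_eq_norm_sq, BandFoliation.inner_eq_three, hq1] at this
    nlinarith
  rw [height_apply, BandFoliation.inner_eq_three, ha1, hq1]
  linear_combination (a 0 ^ 2 + a 2 ^ 2) * hsq - (a 2 * y 0 - a 0 * y 2) * hlag

end IsSimplifiedBrokenLefschetzFibration

end Literature.Topology.FourManifolds
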